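import Literature.Barriers.CriticalPhenomena.LongRangeTrivialityOnZ3Susceptibility
import Literature.Barriers.CriticalPhenomena.LongRangeTrivialityOnZ3MMSWalk

/-!
# The barrier `LongRangeTrivialityOnZ3` WITHOUT the sliding-scale infrared bound (Panis 2023,
# Theorem 3.18): `S(β,L,f)` on `ℤ³` from the tree diagram bound, MMS2 and the infrared bound

Sibling of `Literature/Barriers/CriticalPhenomena/LongRangeTrivialityOnZ3.lean` (barrier catalogue
D-0021, sub-problem `Ising3DConformalLimit`). `…UrsellSum` / `…Susceptibility` derive the barrier
(`LongRangeTrivialityOnZ3.of_twoPoint`, `.of_twoPoint'`) from printed named facts among which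
`panis_slidingScale_infraredBound` — Panis 2023 (arXiv:2309.05797), Theorem 3.18, the sliding-scale
infrared bound of Aizenman–Duminil-Copin 2021 (Theorem 5.6 there) extended to reflection-positive
long-range couplings, used twice on p. 22 (proof of Theorem 5.5) to compare `χ` between two scales.
This file removes that fact from the barrier's trust base:

* `LongRangeIsing.panis_ursellFourBoxSum_le_dim3_mms` — the SAME conclusion as
  `panis_ursellFourBoxSum_le_dim3` (`S(β,L,R) ≤ C(β⁻⁴∨β⁻²)R^γ/L^{3-2α}` for `0 < β ≤ β_c`, `L, R ≥ 1`,
  `α < 3/2`; here `γ = 15`) from `panis_treeDiagramBound`, `panis_mms_two_point_monotone`,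
  `panis_infraredBound_algebraic`, `panis_boxSusceptibility_le_blockVariance` only;
* `panis_thm12_dim3_of_twoPoint_mms`, `LongRangeTrivialityOnZ3.of_twoPoint_mms`, and
  **`LongRangeTrivialityOnZ3.of_fourFacts : panis_evenMoment_deviation_le →
  newman_gaussian_evenMoment_le → panis_treeDiagramBound → panis_infraredBound_algebraic →
  LongRangeTrivialityOnZ3`**, MMS2 being proved (`panis_mms_two_point_monotone_holds`, `…MMSWalk`) and
  `χ_L ≤ C₂L^{-d}Σ_L` derived from it (`panis_boxSusceptibility_le_blockVariance_of_mms`,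
  `…Susceptibility`).

## Why avoid Theorem 3.18 here

1. What p. 22 uses it for. Bound on (1): `χ_{2dr_fL} ≤ (C/β)(2dr_f)²χ_L` — a comparison between two
   scales whose RATIO is a constant; bound on (2): `⟨σ_xσ_{x_i}⟩ ≤ C₅|x|^{-d}χ_{|x|/d} ≤
   C₆χ_L/(βL²|x|^{d-2})` — a decay `|x|^{-(d-2)}` for the two factors not bounded by the infrared bound.
   The Messager–Miracle-Solé monotonicity (MMS2) alone gives the "naive" comparison
   `χ_m ≤ (1+(3d)^d)(m/ℓ)^dχ_ℓ` (`boxSusceptibility_le_scaleRatio_pow_mul`; cf. the remark after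
   Theorem 5.6 of Aizenman–Duminil-Copin 2021, `χ_L/L^d ≲ χ_ℓ/ℓ^d`) and `⟨σ_uσ_y⟩ ≤ χ_L/|Λ_L|` for
   `|u-y|_∞ ≥ dL` (`pairCorrelation_far_le_mms`). In `d = 3` these give (1) with `R³` in place of
   `R²/β`, and in (2) two factors `χ_L/L³` (no decay in `|x|`) times two infrared factors
   `|x|^{-(1+η)}`, `η = 2-α`; the far sum `∑_{|x|>4RL}|x|^{-(2+2η)}` converges iff `η > 1/2`, i.e. iff
   `α < 3/2` — exactly the hypothesis `3 - 2(α∧2) > 0` of Theorem 1.2 on `ℤ³` — and the powers of `L`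
   recombine to the same rate `L^{1-2η} = L^{-(3-2α)}` (`near_term_le_mms`, `far_term_le_mms`). The
   factor `β⁻⁴ ∨ β⁻²` of the vendored shape is recovered from `1 ≤ (β_c²∨1)β⁻²` for `β ≤ β_c`.
2. The printed proof of Theorem 3.18 for these couplings. Panis proves Theorem 3.18 "along the exact
   same lines" as Aizenman–Duminil-Copin once Corollary 3.17 (`Ŝ(p) ≥ Ŝ((|p|₁,0_⊥)) - C/β`) is
   available, and Corollary 3.17 rests on Proposition 3.16, whose proof (Appendix, "Proof of
   Proposition 3.16") starts from "Reflection positivity with respect to `R` implies …", `R` the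
   reflection through the hyperplane orthogonal to `e₁ + e₂` (a DIAGONAL mirror; Proposition 3.2 likewise
   asserts the extension of the MMS inequalities "to reflections with respect to diagonal hyperplanes").
   For pair interactions, reflection positivity across a mirror `Θ` is obtained (Fröhlich–Israel–Lieb–Simon;
   Friedli–Velenik 2017, Lemma 10.8, the route of the tree's `InfraredBoundProofs` /
   `GaussianDominationProofs`) from `-H = A + Θ(A) + ∑_α c_α C_αΘ(C_α)` with `c_α ≥ 0`, i.e. from the
   positive semidefiniteness of the coupling matrix `(J_{x,Θy})_{x,y}` over sites strictly on one side.
   For `J_{x,y} = C₀|x-y|₁^{-d-α}` and the coordinate mirrors this matrix is positive semidefinite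
   (`|x - Θy|₁` splits additively across the mirror and `t ↦ t^{-s}` is completely monotone), but for
   the diagonal mirror of `ℤ²` it is NOT: `LongRangeIsing.algebraicCoupling_diag_not_posSemidef`
   below exhibits, for `α = 1` (`J = |x-y|₁^{-3}`), four sites strictly below the diagonal and weights
   `±1` with `∑ᵢⱼ vᵢvⱼ J_{xᵢ,Rxⱼ} = -85/432 < 0` (PROVED, exact arithmetic). Since
   `⟨σ_xσ_z⟩_β = βJ_{x,z} + O(β²)` (`x ≠ z`) in every volume, `⟨F·R(F)⟩_β = β∑ᵢⱼvᵢvⱼJ_{xᵢ,Rxⱼ} + O(β²) < 0`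
   for small `β > 0` and `F = ∑ᵢvᵢσ_{xᵢ}` (this last step is NOT formalised here), so no state of this
   model is reflection positive across the diagonal for small `β`; the diagonal Messager–Miracle-Solé
   inequality itself is unaffected (it only needs `J_{x,y} ≥ J_{x,Ry}` on one side, Hegerfeldt's folding,
   proved in `…MMS` / `…MMSWalk`). Consequently the printed route to Proposition 3.16, Corollary 3.17
   and Theorem 3.18 does not cover example (iii) `C|x-y|₁^{-d-α}` of the source as it stands, and the
   named fact `panis_slidingScale_infraredBound` (kept as vendored in `…TwoPoint`; its statement follows
   arXiv v1 — the published version, arXiv v2, states Theorem 3.18 for `d ≥ 1` under the sharp-length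
   condition `L(ρ,β) ≥ 3` with a constant `C` in place of `C/β`) is best not relied upon for this
   family. Nothing here asserts that Theorem 3.18 fails for it.

After this file the barrier `LongRangeTrivialityOnZ3` rests on four printed facts:
`panis_evenMoment_deviation_le` (Proposition 4.6 summed; random currents),
`newman_gaussian_evenMoment_le` (Gaussian moments), `panis_treeDiagramBound` (Aizenman 1982) and
`panis_infraredBound_algebraic` (Proposition 3.8, coordinate reflection positivity and the infrared
bound; no diagonal mirrors involved).

## References

* R. Panis, arXiv:2309.05797 (2023) = Ann. Probab. 54 (2026): proof of Theorem 5.5, bounds on (1)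
  and (2) (p. 22); Corollary 3.3 (MMS2); Theorem 3.18, Proposition 3.16, Corollary 3.17 (§3.4);
  Proposition 3.2 and §3.1 example (iii); Appendix "Spectral representation of reflection positive
  Ising models", proof of Proposition 3.16 [Panis2023Triviality] (held, read pp. 13–16, 21–22, 47–48;
  arXiv v2 §3.4 compared).
* M. Aizenman, H. Duminil-Copin, Ann. Math. 194 (2021), Theorem 5.6 and the remark following it
  (eq. (5.27)), Proposition 5.4, Corollary 5.5 [AizenmanDuminilCopinAnnals2021] (held, read pp. 17–19).
* S. Friedli, Y. Velenik, *Statistical Mechanics of Lattice Systems*, CUP (2017), §10.3.2,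
  Lemma 10.8 [FriedliVelenik2017]; J. Fröhlich, R. Israel, E. H. Lieb, B. Simon, Comm. Math. Phys. 62
  (1978) [FrohlichIsraelLiebSimon1978].
-/

noncomputable section

namespace Literature.Barriers.CriticalPhenomena

open Literature.Probability.LatticeModels Literature.Probability.Percolation Filter Topology Finset
open scoped ENNReal

namespace LongRangeIsing

/-! ### Scale comparison of `χ` from MMS2 alone (every `d`) -/

section ScaleComparison

variable {d : ℕ} (J : Site d → Site d → ℝ) (β : ℝ)

/-- **MMS2 averaged over a box**: if `S(y) ≤ S(x)` whenever `d|x|_∞ ≤ |y|_∞`, then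
`|Λ_L| ⟨σ₀σ_y⟩ ≤ χ_L` for `|y|_∞ ≥ dL`. [cite: Panis2023Triviality, Corollary 3.3 (MMS2)] -/
theorem card_box_mul_pairCorrelation_le_boxSusceptibility
    (hmms : ∀ x y : Site d, (d : ℝ) * ‖x‖ ≤ ‖y‖ → pairCorrelation J β 0 y ≤ pairCorrelation J β 0 x)
    {L : ℕ} {y : Site d} (hy : d * L ≤ Site.supNorm y) :
    (#(box d L) : ℝ) * pairCorrelation J β 0 y ≤ boxSusceptibility J β L := by
  rw [boxSusceptibility, ← nsmul_eq_mul, ← Finset.sum_const]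
  refine Finset.sum_le_sum fun x hx => hmms x y ?_
  rw [Site.norm_eq_supNorm, Site.norm_eq_supNorm]
  have hxL := mem_box_iff_supNorm_le.1 hx
  have : d * Site.supNorm x ≤ Site.supNorm y := (Nat.mul_le_mul_left d hxL).trans hy
  exact_mod_cast this

/-- **Comparison of `χ` between two scales from MMS2 alone**: `χ_m ≤ (1 + (3d)^d) (m/ℓ)^d χ_ℓ` for
`1 ≤ ℓ ≤ m` (the "naive" Messager–Miracle-Solé comparison `χ_L/L^d ≲ χ_ℓ/ℓ^d` mentioned after
Theorem 5.6 of Aizenman–Duminil-Copin 2021: outside `Λ_ℓ` average MMS2 over `Λ_{⌊ℓ/d⌋}`).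
[cite: AizenmanDuminilCopinAnnals2021, remark following Theorem 5.6 (eq. (5.27))] -/
theorem boxSusceptibility_le_scaleRatio_pow_mul (hβ : 0 ≤ β) (hJ : ∀ x y, 0 ≤ J x y)
    (hmms : ∀ x y : Site d, (d : ℝ) * ‖x‖ ≤ ‖y‖ → pairCorrelation J β 0 y ≤ pairCorrelation J β 0 x)
    {ℓ m : ℕ} (hℓ : 1 ≤ ℓ) (hℓm : ℓ ≤ m) :
    boxSusceptibility J β m ≤ (1 + ((3 * d) ^ d : ℕ)) * ((m : ℝ) / ℓ) ^ d * boxSusceptibility J β ℓ := by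
  have hS0 : ∀ x y, 0 ≤ pairCorrelation J β x y := pairCorrelation_nonneg J β hβ hJ
  have hχℓ1 : 1 ≤ boxSusceptibility J β ℓ := one_le_boxSusceptibility J β hβ hJ ℓ
  have hχℓ0 : 0 ≤ boxSusceptibility J β ℓ := by linarith
  have hℓ0 : (0 : ℝ) < ℓ := by exact_mod_cast hℓ
  have hm1 : (1 : ℝ) ≤ m := by exact_mod_cast hℓ.trans hℓm
  have hratio1 : 1 ≤ (m : ℝ) / ℓ := by
    rw [le_div_iff₀ hℓ0, one_mul]
    exact_mod_cast hℓm
  have hratio0 : 0 ≤ ((m : ℝ) / ℓ) ^ d := by positivity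
  -- `|Λ_m| ≤ 3^d (m/ℓ)^d ℓ^d`
  have hcardm : (#(box d m) : ℝ) ≤ (3 : ℝ) ^ d * ((m : ℝ) / ℓ) ^ d * (ℓ : ℝ) ^ d := by
    rw [card_box]
    push_cast
    have h1 : 2 * (m : ℝ) + 1 ≤ 3 * m := by linarith
    calc (2 * (m : ℝ) + 1) ^ d ≤ (3 * (m : ℝ)) ^ d := pow_le_pow_left₀ (by positivity) h1 d
      _ = (3 : ℝ) ^ d * ((m : ℝ) / ℓ) ^ d * (ℓ : ℝ) ^ d := by
          rw [← mul_pow, ← mul_pow]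
          congr 1
          field_simp
  have hχm_card : boxSusceptibility J β m ≤ #(box d m) := by
    calc boxSusceptibility J β m ≤ ∑ _x ∈ box d m, (1 : ℝ) :=
          Finset.sum_le_sum fun x _ => (le_abs_self _).trans (abs_pairCorrelation_le_one J β hβ hJ 0 x)
      _ = #(box d m) := by rw [Finset.sum_const, nsmul_eq_mul, mul_one]
  set k : ℕ := ℓ / d with hk
  rcases Nat.eq_zero_or_pos k with hk0 | hkpos
  · -- `ℓ < d` (or `d = 0`): `χ_m ≤ |Λ_m| ≤ (3d)^d (m/ℓ)^d ≤ (3d)^d (m/ℓ)^d χ_ℓ`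
    have hℓd : (ℓ : ℝ) ^ d ≤ (d : ℝ) ^ d := by
      rcases Nat.eq_zero_or_pos d with hd0 | hdpos
      · subst hd0
        simp
      · have hlt : ℓ < d := by
          rw [hk] at hk0
          exact (Nat.div_eq_zero_iff_lt hdpos).1 hk0
        exact_mod_cast Nat.pow_le_pow_left hlt.le d
    calc boxSusceptibility J β m ≤ #(box d m) := hχm_card
      _ ≤ (3 : ℝ) ^ d * ((m : ℝ) / ℓ) ^ d * (ℓ : ℝ) ^ d := hcardm
      _ ≤ (3 : ℝ) ^ d * ((m : ℝ) / ℓ) ^ d * (d : ℝ) ^ d := by gcongr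
      _ = ((3 * d) ^ d : ℕ) * ((m : ℝ) / ℓ) ^ d := by push_cast; ring
      _ ≤ ((3 * d) ^ d : ℕ) * ((m : ℝ) / ℓ) ^ d * boxSusceptibility J β ℓ :=
          le_mul_of_one_le_right (by positivity) hχℓ1
      _ ≤ (1 + ((3 * d) ^ d : ℕ)) * ((m : ℝ) / ℓ) ^ d * boxSusceptibility J β ℓ := by
          gcongr
          linarith
  · -- `k ≥ 1`: `dk ≤ ℓ < d(k+1)`; outside `Λ_ℓ` average MMS2 over `Λ_k`
    have hdpos : 0 < d := Nat.pos_of_ne_zero fun hd0 => by rw [hk, hd0, Nat.div_zero] at hkpos; exact lt_irrefl 0 hkpos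
    have hdk : d * k ≤ ℓ := by rw [hk]; exact Nat.mul_div_le ℓ d
    have hℓlt : ℓ < d * (k + 1) := by rw [hk]; exact Nat.lt_mul_div_succ ℓ hdpos
    have hkℓ : k ≤ ℓ := by
      calc k ≤ d * k := Nat.le_mul_of_pos_left k hdpos
        _ ≤ ℓ := hdk
    have hcardk : (0 : ℝ) < #(box d k) := by exact_mod_cast (box_nonempty d k).card_pos
    -- far part
    have hfar : ∀ y ∈ box d m \ box d ℓ, pairCorrelation J β 0 y ≤ boxSusceptibility J β ℓ / #(box d k) := by
      intro y hy
      rw [Finset.mem_sdiff, mem_box_iff_supNorm_le, mem_box_iff_supNorm_le] at hy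
      rw [le_div_iff₀ hcardk, mul_comm]
      have h1 := card_box_mul_pairCorrelation_le_boxSusceptibility J β hmms (L := k) (y := y) (by omega)
      exact h1.trans (boxSusceptibility_mono J β hβ hJ hkℓ)
    -- `|Λ_m| / |Λ_k| ≤ (3d)^d (m/ℓ)^d`
    have hcards : (#(box d m) : ℝ) ≤ ((3 * d) ^ d : ℕ) * ((m : ℝ) / ℓ) ^ d * #(box d k) := by
      have h1 : (ℓ : ℝ) ≤ d * (2 * k + 1) := by
        have : ℓ ≤ d * (2 * k + 1) := by nlinarith
        exact_mod_cast this
      have h2 : (ℓ : ℝ) ^ d ≤ ((d : ℝ) * (2 * k + 1)) ^ d := pow_le_pow_left₀ (by positivity) h1 d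
      rw [card_box d k]
      push_cast
      calc (#(box d m) : ℝ) ≤ (3 : ℝ) ^ d * ((m : ℝ) / ℓ) ^ d * (ℓ : ℝ) ^ d := hcardm
        _ ≤ (3 : ℝ) ^ d * ((m : ℝ) / ℓ) ^ d * ((d : ℝ) * (2 * k + 1)) ^ d := by gcongr
        _ = (3 * (d : ℝ)) ^ d * ((m : ℝ) / ℓ) ^ d * (2 * (k : ℝ) + 1) ^ d := by
            rw [mul_pow, mul_pow]
            ring
    have hsplit : boxSusceptibility J β m =
        ∑ y ∈ box d m \ box d ℓ, pairCorrelation J β 0 y + boxSusceptibility J β ℓ := by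
      rw [boxSusceptibility, boxSusceptibility, Finset.sum_sdiff (box_mono d hℓm)]
    have hsum_far : ∑ y ∈ box d m \ box d ℓ, pairCorrelation J β 0 y ≤
        ((3 * d) ^ d : ℕ) * ((m : ℝ) / ℓ) ^ d * boxSusceptibility J β ℓ := by
      calc ∑ y ∈ box d m \ box d ℓ, pairCorrelation J β 0 y
          ≤ ∑ _y ∈ box d m \ box d ℓ, boxSusceptibility J β ℓ / #(box d k) := Finset.sum_le_sum hfar
        _ = (#(box d m \ box d ℓ) : ℝ) * (boxSusceptibility J β ℓ / #(box d k)) := by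
            rw [Finset.sum_const, nsmul_eq_mul]
        _ ≤ (#(box d m) : ℝ) * (boxSusceptibility J β ℓ / #(box d k)) := by
            refine mul_le_mul_of_nonneg_right ?_ (div_nonneg hχℓ0 hcardk.le)
            exact_mod_cast Finset.card_le_card Finset.sdiff_subset
        _ ≤ ((3 * d) ^ d : ℕ) * ((m : ℝ) / ℓ) ^ d * #(box d k) * (boxSusceptibility J β ℓ / #(box d k)) :=
            mul_le_mul_of_nonneg_right hcards (div_nonneg hχℓ0 hcardk.le)
        _ = ((3 * d) ^ d : ℕ) * ((m : ℝ) / ℓ) ^ d * boxSusceptibility J β ℓ := by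
            field_simp
    have hnear : boxSusceptibility J β ℓ ≤ ((m : ℝ) / ℓ) ^ d * boxSusceptibility J β ℓ :=
      le_mul_of_one_le_left hχℓ0 (one_le_pow₀ hratio1)
    rw [hsplit]
    calc ∑ y ∈ box d m \ box d ℓ, pairCorrelation J β 0 y + boxSusceptibility J β ℓ
        ≤ ((3 * d) ^ d : ℕ) * ((m : ℝ) / ℓ) ^ d * boxSusceptibility J β ℓ + ((m : ℝ) / ℓ) ^ d * boxSusceptibility J β ℓ :=
          add_le_add hsum_far hnear
      _ = (1 + ((3 * d) ^ d : ℕ)) * ((m : ℝ) / ℓ) ^ d * boxSusceptibility J β ℓ := by ring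

end ScaleComparison

/-! ### `d = 3`: the two-point function far from the box and the row sums, from MMS2 alone -/

section FarNearZ3

variable (J : Site 3 → Site 3 → ℝ) (β : ℝ)

/-- **MMS2 far from the box** (replacing display (5.2) of the source): for `|u|_∞ ≥ 4RL+1`,
`y ∈ Λ_{RL}` (`R ≥ 1`), `⟨σ_uσ_y⟩ ≤ χ_L(β)/|Λ_L|` — indeed `|u-y|_∞ ≥ 3RL+1 ≥ 3L`, so MMS2 compares
`⟨σ₀σ_{y-u}⟩` with every `⟨σ₀σ_z⟩`, `z ∈ Λ_L`. [cite: Panis2023Triviality, Corollary 3.3 (MMS2)] -/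
theorem pairCorrelation_far_le_mms (hβ : 0 ≤ β) (hJ : ∀ x y, 0 ≤ J x y)
    (hJt : ∀ a x y, J (x + a) (y + a) = J x y)
    (hmms : ∀ x y : Site 3, (3 : ℝ) * ‖x‖ ≤ ‖y‖ → pairCorrelation J β 0 y ≤ pairCorrelation J β 0 x)
    {R L : ℕ} (hR : 1 ≤ R) {u y : Site 3} (hu : 4 * (R * L) + 1 ≤ Site.supNorm u) (hy : y ∈ box 3 (R * L)) :
    pairCorrelation J β u y ≤ boxSusceptibility J β L / #(box 3 L) := by
  set w : Site 3 := y - u with hw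
  have hyRL : Site.supNorm y ≤ R * L := mem_box_iff_supNorm_le.1 hy
  have htri : Site.supNorm u ≤ Site.supNorm w + Site.supNorm y := by
    have h := Site.supNorm_le_supNorm_sub_add u y
    rwa [← Site.supNorm_neg (u - y), neg_sub, ← hw] at h
  have hLRL : L ≤ R * L := Nat.le_mul_of_pos_left L (by omega)
  have hw3 : 3 * L ≤ Site.supNorm w := by omega
  have hcard0 : (0 : ℝ) < #(box 3 L) := by exact_mod_cast (box_nonempty 3 L).card_pos
  have hmms' : ∀ x y : Site 3, ((3 : ℕ) : ℝ) * ‖x‖ ≤ ‖y‖ → pairCorrelation J β 0 y ≤ pairCorrelation J β 0 x :=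
    fun x y h => hmms x y (by exact_mod_cast h)
  rw [le_div_iff₀ hcard0, mul_comm, ← pairCorrelation_zero_sub J β hβ hJ hJt u y]
  exact card_box_mul_pairCorrelation_le_boxSusceptibility J β hmms' hw3

/-- **Near the box, from MMS2 alone** (replacing the use of Theorem 3.18 in the bound on (1)): for
`u ∈ Λ_{4RL}`, `F_{RL}(u) ≤ χ_{5RL}(β) ≤ 730 · 125R³ · χ_L(β)` (translation invariance, then the scale
comparison `boxSusceptibility_le_scaleRatio_pow_mul` between `L` and `5RL`).
[cite: Panis2023Triviality, proof of Theorem 5.5, bound on (1), p. 22, with Corollary 3.3 (MMS2)] -/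
theorem boxRowSum_le_near_mms (hβ : 0 ≤ β) (hJ : ∀ x y, 0 ≤ J x y) (hJt : ∀ a x y, J (x + a) (y + a) = J x y)
    (hmms : ∀ x y : Site 3, (3 : ℝ) * ‖x‖ ≤ ‖y‖ → pairCorrelation J β 0 y ≤ pairCorrelation J β 0 x)
    {R L : ℕ} (hR : 1 ≤ R) (hL : 1 ≤ L) {u : Site 3} (hu : u ∈ box 3 (4 * (R * L))) :
    boxRowSum J β (R * L) u ≤ 730 * (125 * (R : ℝ) ^ 3) * boxSusceptibility J β L := by
  have hRL : 1 ≤ R * L := Nat.one_le_iff_ne_zero.2 (Nat.mul_ne_zero (by omega) (by omega))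
  have h1 : boxRowSum J β (R * L) u ≤ boxSusceptibility J β (5 * (R * L)) := by
    have h := sum_box_pairCorrelation_le J β hβ hJ hJt (N := R * L) hu
    rwa [show R * L + 4 * (R * L) = 5 * (R * L) by ring] at h
  have hmms' : ∀ x y : Site 3, ((3 : ℕ) : ℝ) * ‖x‖ ≤ ‖y‖ → pairCorrelation J β 0 y ≤ pairCorrelation J β 0 x :=
    fun x y h => hmms x y (by exact_mod_cast h)
  have h2 := boxSusceptibility_le_scaleRatio_pow_mul J β hβ hJ hmms' hL (m := 5 * (R * L)) (by nlinarith)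
  have hL0 : (0 : ℝ) < L := by exact_mod_cast hL
  have h3 : (1 + ((3 * 3) ^ 3 : ℕ)) * (((5 * (R * L) : ℕ) : ℝ) / L) ^ 3 * boxSusceptibility J β L =
      730 * (125 * (R : ℝ) ^ 3) * boxSusceptibility J β L := by
    have e : ((5 * (R * L) : ℕ) : ℝ) / L = 5 * R := by
      push_cast
      field_simp
    rw [e]
    push_cast
    ring
  linarith [h1, h2, h3.le, h3.ge]

/-- **Far from the box, from MMS2 and the infrared bound** (replacing the bound on (2)): for
`|u|_∞ ≥ 4RL+1`, `F_{RL}(u)⁴ ≤ B |u|_∞^{-(2+2η)}` with `B = 9 C_E² (2RL+1)^{12} χ_L² / L⁶` (two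
factors through `pairCorrelation_far_le_mms` and `|Λ_L| ≥ L³`, two through the infrared bound
`⟨σ₀σ_x⟩ ≤ C_E|x|^{-(1+η)}`). [cite: Panis2023Triviality, proof of Theorem 5.5, bound on (2), p. 22, with Corollary 3.3 (MMS2)] -/
theorem boxRowSum_pow_four_le_far_mms (hβ : 0 ≤ β) (hJ : ∀ x y, 0 ≤ J x y)
    (hJt : ∀ a x y, J (x + a) (y + a) = J x y)
    (hmms : ∀ x y : Site 3, (3 : ℝ) * ‖x‖ ≤ ‖y‖ → pairCorrelation J β 0 y ≤ pairCorrelation J β 0 x)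
    {η : ℝ} (hη0 : 0 ≤ η) (hη2 : η < 2)
    {CE : ℝ} (hE : ∀ x : Site 3, x ≠ 0 → pairCorrelation J β 0 x ≤ CE / ‖x‖ ^ (1 + η))
    {R L : ℕ} (hR : 1 ≤ R) (hL : 1 ≤ L) {u : Site 3} (hu : 4 * (R * L) + 1 ≤ Site.supNorm u) :
    boxRowSum J β (R * L) u ^ 4 ≤
      9 * CE ^ 2 * ((2 * (R * L) + 1 : ℕ) : ℝ) ^ 12 * boxSusceptibility J β L ^ 2 / (L : ℝ) ^ 6 *
        (Site.supNorm u : ℝ) ^ (-(2 + 2 * η)) := by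
  set V : ℝ := ((2 * (R * L) + 1 : ℕ) : ℝ) ^ 3 with hV
  set Nu : ℝ := (Site.supNorm u : ℝ) with hNu
  have hupos : 0 < Site.supNorm u := by omega
  have hNu0 : 0 < Nu := by rw [hNu]; exact_mod_cast hupos
  have hL0 : (0 : ℝ) < L := by exact_mod_cast hL
  have hχ0 : 0 ≤ boxSusceptibility J β L := boxSusceptibility_nonneg J β hβ hJ L
  set b₁ : ℝ := boxSusceptibility J β L / (L : ℝ) ^ 3 with hb₁
  set b₂ : ℝ := 3 * CE * Nu ^ (-(1 + η)) with hb₂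
  have hF0 : 0 ≤ boxRowSum J β (R * L) u := boxRowSum_nonneg J β hβ hJ _ u
  have hcard : (#(box 3 (R * L)) : ℝ) = V := by rw [card_box, hV]; norm_cast
  have hcardL : (L : ℝ) ^ 3 ≤ #(box 3 L) := by
    rw [card_box]
    exact_mod_cast Nat.pow_le_pow_left (by omega : L ≤ 2 * L + 1) 3
  have hpt : ∀ y ∈ box 3 (R * L), pairCorrelation J β u y ≤ b₁ := by
    intro y hy
    calc pairCorrelation J β u y ≤ boxSusceptibility J β L / #(box 3 L) :=
          pairCorrelation_far_le_mms J β hβ hJ hJt hmms hR hu hy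
      _ ≤ boxSusceptibility J β L / (L : ℝ) ^ 3 := div_le_div_of_nonneg_left hχ0 (by positivity) hcardL
  have hF1 : boxRowSum J β (R * L) u ≤ V * b₁ := by
    rw [boxRowSum, ← hcard, ← nsmul_eq_mul, ← Finset.sum_const]
    exact Finset.sum_le_sum hpt
  have hF2 : boxRowSum J β (R * L) u ≤ V * b₂ := by
    rw [boxRowSum, ← hcard, ← nsmul_eq_mul, ← Finset.sum_const]
    exact Finset.sum_le_sum fun y hy => pairCorrelation_far_le_irb J β hβ hJ hJt hη0 hη2 hE hu hy
  have hsq1 : boxRowSum J β (R * L) u ^ 2 ≤ (V * b₁) ^ 2 := pow_le_pow_left₀ hF0 hF1 2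
  have hsq2 : boxRowSum J β (R * L) u ^ 2 ≤ (V * b₂) ^ 2 := pow_le_pow_left₀ hF0 hF2 2
  have h4 : boxRowSum J β (R * L) u ^ 4 ≤ (V * b₁) ^ 2 * (V * b₂) ^ 2 := by
    rw [show boxRowSum J β (R * L) u ^ 4 = boxRowSum J β (R * L) u ^ 2 * boxRowSum J β (R * L) u ^ 2 by ring]
    exact mul_le_mul hsq1 hsq2 (sq_nonneg _) (sq_nonneg _)
  refine h4.trans (le_of_eq ?_)
  rw [hb₁, hb₂, hV]
  have hpow : Nu ^ (-(2 + 2 * η)) = (Nu ^ (-(1 + η))) ^ 2 := by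
    rw [← Real.rpow_natCast (Nu ^ (-(1 + η))) 2, ← Real.rpow_mul hNu0.le]
    norm_num
    ring_nf
  rw [hpow]
  field_simp
  ring

end FarNearZ3

/-! ### Bookkeeping of the powers of `L` and `R` (no powers of `β`) -/

section AlgebraMMS

/-- **The near term**: `2|Λ_{4RL}|(730·125R³χ_L)⁴/Σ_L² ≤ K₁ R¹⁵ L^{1-2η}` granted `χ_L ≤ C₄L^{2-η}` and
`χ_L ≤ C₂L^{-3}Σ_L`, with `K₁ = 2·729·(730·125)⁴C₄²C₂²`. [cite: Panis2023Triviality, proof of Theorem 5.5, bound on (1) (last two displays), p. 22] -/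
theorem near_term_le_mms {C₂ C₄ χ V η : ℝ} {R L : ℕ} (hχ0 : 0 ≤ χ) (hV : 1 ≤ V)
    (hR : 1 ≤ R) (hL : 1 ≤ L) (hχ4 : χ ≤ C₄ * (L : ℝ) ^ (2 - η)) (hχV : χ ≤ C₂ * ((L : ℝ) ^ 3)⁻¹ * V) :
    2 * (#(box 3 (4 * (R * L))) : ℝ) * (730 * (125 * (R : ℝ) ^ 3) * χ) ^ 4 / V ^ 2 ≤
      (2 * 729 * (730 * 125) ^ 4 * C₄ ^ 2 * C₂ ^ 2) * (R : ℝ) ^ (15 : ℝ) * (L : ℝ) ^ (1 - 2 * η) := by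
  have hR0 : (0 : ℝ) < R := by exact_mod_cast hR
  have hL0 : (0 : ℝ) < L := by exact_mod_cast hL
  have hV0 : 0 < V := by linarith
  have hratio : χ / V ≤ C₂ * ((L : ℝ) ^ 3)⁻¹ := by
    rw [div_le_iff₀ hV0]
    exact hχV
  have hratio0 : 0 ≤ χ / V := div_nonneg hχ0 hV0.le
  have hcard : (#(box 3 (4 * (R * L))) : ℝ) ≤ 729 * (R : ℝ) ^ 3 * (L : ℝ) ^ 3 := by
    rw [card_box]
    push_cast
    have h1 : (1 : ℝ) ≤ R * L := by
      have := mul_le_mul (show (1:ℝ) ≤ R by exact_mod_cast hR) (show (1:ℝ) ≤ L by exact_mod_cast hL) zero_le_one hR0.le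
      linarith
    nlinarith [h1, mul_pos hR0 hL0, sq_nonneg ((R : ℝ) * L)]
  have e1 : 2 * (#(box 3 (4 * (R * L))) : ℝ) * (730 * (125 * (R : ℝ) ^ 3) * χ) ^ 4 / V ^ 2 =
      2 * (#(box 3 (4 * (R * L))) : ℝ) * ((730 * 125 : ℝ) ^ 4 * (R : ℝ) ^ 12) * (χ ^ 2 * (χ / V) ^ 2) := by
    field_simp
  rw [e1]
  have hsq1 : χ ^ 2 ≤ (C₄ * (L : ℝ) ^ (2 - η)) ^ 2 := pow_le_pow_left₀ hχ0 hχ4 2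
  have hsq2 : (χ / V) ^ 2 ≤ (C₂ * ((L : ℝ) ^ 3)⁻¹) ^ 2 := pow_le_pow_left₀ hratio0 hratio 2
  calc 2 * (#(box 3 (4 * (R * L))) : ℝ) * ((730 * 125 : ℝ) ^ 4 * (R : ℝ) ^ 12) * (χ ^ 2 * (χ / V) ^ 2)
      ≤ 2 * (729 * (R : ℝ) ^ 3 * (L : ℝ) ^ 3) * ((730 * 125 : ℝ) ^ 4 * (R : ℝ) ^ 12) *
          ((C₄ * (L : ℝ) ^ (2 - η)) ^ 2 * (C₂ * ((L : ℝ) ^ 3)⁻¹) ^ 2) := by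
        gcongr
    _ = (2 * 729 * (730 * 125) ^ 4 * C₄ ^ 2 * C₂ ^ 2) * ((R : ℝ) ^ 3 * (R : ℝ) ^ 12) *
          ((L : ℝ) ^ 3 * ((L : ℝ) ^ (2 - η)) ^ 2 * (((L : ℝ) ^ 3)⁻¹) ^ 2) := by ring
    _ = (2 * 729 * (730 * 125) ^ 4 * C₄ ^ 2 * C₂ ^ 2) * (R : ℝ) ^ (15 : ℝ) * (L : ℝ) ^ (1 - 2 * η) := by
        rw [rpow_bookkeeping_near hL0, ← pow_add, show (15 : ℝ) = ((15 : ℕ) : ℝ) by norm_num, Real.rpow_natCast]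

/-- **The far term**: `2 B · 26(4RL)^{3-q}/(q-3) / Σ_L² ≤ K₂ R¹⁵ L^{1-2η}` with
`B = 9C_E²(2RL+1)¹²χ_L²/L⁶`, `q = 2+2η > 3` (i.e. `η > 1/2`), granted `χ_L ≤ C₂L^{-3}Σ_L`, with
`K₂ = 2·26·9·3¹²C_E²C₂²/(2η-1)`. [cite: Panis2023Triviality, proof of Theorem 5.5, bound on (2) (last display), p. 22] -/
theorem far_term_le_mms {CE C₂ χ V η : ℝ} {R L : ℕ} (hχ0 : 0 ≤ χ) (hV : 1 ≤ V) (hη : 1 / 2 < η)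
    (hR : 1 ≤ R) (hL : 1 ≤ L) (hχV : χ ≤ C₂ * ((L : ℝ) ^ 3)⁻¹ * V) :
    2 * (9 * CE ^ 2 * ((2 * (R * L) + 1 : ℕ) : ℝ) ^ 12 * χ ^ 2 / (L : ℝ) ^ 6) *
        (26 * (((4 * (R * L) : ℕ) : ℝ)) ^ (3 - (2 + 2 * η)) / (2 + 2 * η - 3)) / V ^ 2 ≤
      (2 * 26 * 9 * 3 ^ 12 * CE ^ 2 * C₂ ^ 2 / (2 * η - 1)) * (R : ℝ) ^ (15 : ℝ) * (L : ℝ) ^ (1 - 2 * η) := by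
  have hR0 : (0 : ℝ) < R := by exact_mod_cast hR
  have hL0 : (0 : ℝ) < L := by exact_mod_cast hL
  have hR1 : (1 : ℝ) ≤ R := by exact_mod_cast hR
  have hV0 : 0 < V := by linarith
  have hη1 : 0 < 2 * η - 1 := by linarith
  have hratio : χ / V ≤ C₂ * ((L : ℝ) ^ 3)⁻¹ := by
    rw [div_le_iff₀ hV0]
    exact hχV
  have hratio0 : 0 ≤ χ / V := div_nonneg hχ0 hV0.le
  have hsq2 : (χ / V) ^ 2 ≤ (C₂ * ((L : ℝ) ^ 3)⁻¹) ^ 2 := pow_le_pow_left₀ hratio0 hratio 2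
  have hvol : ((2 * (R * L) + 1 : ℕ) : ℝ) ^ 12 ≤ (3 : ℝ) ^ 12 * (R : ℝ) ^ 12 * (L : ℝ) ^ 12 := by
    have h1 : ((2 * (R * L) + 1 : ℕ) : ℝ) ≤ 3 * ((R : ℝ) * L) := by
      push_cast
      have : (1 : ℝ) ≤ (R : ℝ) * L := by
        have := mul_le_mul hR1 (show (1:ℝ) ≤ L by exact_mod_cast hL) zero_le_one hR0.le
        linarith
      linarith
    calc ((2 * (R * L) + 1 : ℕ) : ℝ) ^ 12 ≤ (3 * ((R : ℝ) * L)) ^ 12 := pow_le_pow_left₀ (by positivity) h1 12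
      _ = (3 : ℝ) ^ 12 * (R : ℝ) ^ 12 * (L : ℝ) ^ 12 := by ring
  -- `(4RL)^{3-q} = (4R)^{1-2η} L^{1-2η} ≤ L^{1-2η}`
  have hM : (((4 * (R * L) : ℕ) : ℝ)) ^ (3 - (2 + 2 * η)) ≤ (L : ℝ) ^ (1 - 2 * η) := by
    have e : (3 : ℝ) - (2 + 2 * η) = 1 - 2 * η := by ring
    rw [e]
    push_cast
    rw [show (4 : ℝ) * ((R : ℝ) * L) = (4 * (R : ℝ)) * L by ring, Real.mul_rpow (by positivity) hL0.le]
    have h4 : (4 * (R : ℝ)) ^ (1 - 2 * η) ≤ 1 :=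
      Real.rpow_le_one_of_one_le_of_nonpos (by linarith) (by linarith)
    have hrest : 0 ≤ (L : ℝ) ^ (1 - 2 * η) := Real.rpow_nonneg hL0.le _
    calc (4 * (R : ℝ)) ^ (1 - 2 * η) * (L : ℝ) ^ (1 - 2 * η) ≤ 1 * (L : ℝ) ^ (1 - 2 * η) :=
        mul_le_mul_of_nonneg_right h4 hrest
      _ = (L : ℝ) ^ (1 - 2 * η) := one_mul _
  have hM0 : 0 ≤ (((4 * (R * L) : ℕ) : ℝ)) ^ (3 - (2 + 2 * η)) := Real.rpow_nonneg (Nat.cast_nonneg _) _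
  -- `R^{12} ≤ R^{15}`
  have hRpow : (R : ℝ) ^ 12 ≤ (R : ℝ) ^ (15 : ℝ) := by
    rw [← Real.rpow_natCast (R : ℝ) 12]
    exact Real.rpow_le_rpow_of_exponent_le hR1 (by norm_num)
  have hL6 : (L : ℝ) ^ 12 * ((L : ℝ) ^ 6)⁻¹ * (((L : ℝ) ^ 3)⁻¹) ^ 2 = 1 := by
    field_simp
  have e1 : 2 * (9 * CE ^ 2 * ((2 * (R * L) + 1 : ℕ) : ℝ) ^ 12 * χ ^ 2 / (L : ℝ) ^ 6) *
        (26 * (((4 * (R * L) : ℕ) : ℝ)) ^ (3 - (2 + 2 * η)) / (2 + 2 * η - 3)) / V ^ 2 =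
      (2 * 26 * 9 * CE ^ 2 / (2 * η - 1)) * (((2 * (R * L) + 1 : ℕ) : ℝ) ^ 12 *
        ((((4 * (R * L) : ℕ) : ℝ)) ^ (3 - (2 + 2 * η)) * (((L : ℝ) ^ 6)⁻¹ * (χ / V) ^ 2))) := by
    rw [show (2 : ℝ) + 2 * η - 3 = 2 * η - 1 by ring]
    field_simp
  rw [e1]
  calc (2 * 26 * 9 * CE ^ 2 / (2 * η - 1)) * (((2 * (R * L) + 1 : ℕ) : ℝ) ^ 12 *
        ((((4 * (R * L) : ℕ) : ℝ)) ^ (3 - (2 + 2 * η)) * (((L : ℝ) ^ 6)⁻¹ * (χ / V) ^ 2)))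
      ≤ (2 * 26 * 9 * CE ^ 2 / (2 * η - 1)) * (((3 : ℝ) ^ 12 * (R : ℝ) ^ 12 * (L : ℝ) ^ 12) *
        ((L : ℝ) ^ (1 - 2 * η) * (((L : ℝ) ^ 6)⁻¹ * (C₂ * ((L : ℝ) ^ 3)⁻¹) ^ 2))) := by
        gcongr
    _ = (2 * 26 * 9 * 3 ^ 12 * CE ^ 2 * C₂ ^ 2 / (2 * η - 1)) * (R : ℝ) ^ 12 *
        (((L : ℝ) ^ 12 * ((L : ℝ) ^ 6)⁻¹ * (((L : ℝ) ^ 3)⁻¹) ^ 2) * (L : ℝ) ^ (1 - 2 * η)) := by ring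
    _ ≤ (2 * 26 * 9 * 3 ^ 12 * CE ^ 2 * C₂ ^ 2 / (2 * η - 1)) * (R : ℝ) ^ (15 : ℝ) *
        (((L : ℝ) ^ 12 * ((L : ℝ) ^ 6)⁻¹ * (((L : ℝ) ^ 3)⁻¹) ^ 2) * (L : ℝ) ^ (1 - 2 * η)) := by
        gcongr
    _ = (2 * 26 * 9 * 3 ^ 12 * CE ^ 2 * C₂ ^ 2 / (2 * η - 1)) * (R : ℝ) ^ (15 : ℝ) * (L : ℝ) ^ (1 - 2 * η) := by
        rw [hL6, one_mul]

end AlgebraMMS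

end LongRangeIsing

open LongRangeIsing

/-! ### `S(β,L,f)` on `ℤ³` WITHOUT the sliding-scale infrared bound -/

/-- **Panis's bound on `S(β,L,f)` for `d = 3` from the tree diagram bound, MMS2, the infrared bound
and `χ_L ≤ C₂L^{-3}Σ_L` — Theorem 3.18 (sliding-scale infrared bound) is NOT used.** For
`J_{x,y} = C₀|x-y|₁^{-3-α}` with `3 - 2(α∧2) > 0` (i.e. `α < 3/2`, `η = 2-α > 1/2`) there are `C, γ > 0`
(`γ = 15`) with `S(β,L,R) ≤ C (β⁻⁴ ∨ β⁻²) R^γ / L^{3-2α}` for all `0 < β ≤ β_c`, `L, R ≥ 1` — the same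
conclusion as `panis_ursellFourBoxSum_le_dim3`. Route: as on p. 22 of the source, but in the near
region `F(u) ≤ χ_{5RL} ≤ 730·125R³χ_L` by the MMS2 scale comparison (`boxRowSum_le_near_mms`), and in
the far region two factors `⟨σ_uσ_y⟩ ≤ χ_L/L³` by MMS2 (`pairCorrelation_far_le_mms`) and two factors
`3C_E|u|^{-(1+η)}` by the infrared bound, so that `F(u)⁴ ≤ B|u|^{-(2+2η)}` with `∑_{|u|>4RL}|u|^{-(2+2η)} < ∞`
exactly when `η > 1/2`; the rate `L^{1-2η} = L^{-(3-2α)}` is unchanged, the `β`-dependence is absorbed by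
`1 ≤ (β_c² ∨ 1) β⁻²` for `β ≤ β_c`. [cite: Panis2023Triviality, proof of Theorem 5.5, bounds on (1) and (2) (p. 22), with Corollary 3.3 (MMS2) and Remark 5.4] -/
theorem panis_ursellFourBoxSum_le_dim3_mms (hT : panis_treeDiagramBound) (hM : panis_mms_two_point_monotone)
    (hI : panis_infraredBound_algebraic) (hX : panis_boxSusceptibility_le_blockVariance)
    {C₀ α : ℝ} (hC₀ : 0 < C₀) (hα : 0 < α) (hexp : 0 < ((3 : ℕ) : ℝ) - 2 * min α 2) :
    ∃ C γ : ℝ, 0 < C ∧ 0 < γ ∧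
      ∀ (β : ℝ), 0 < β → β ≤ LongRangeIsing.criticalBeta (algebraicCoupling 3 C₀ α) →
        ∀ (L R : ℕ), 1 ≤ L → 1 ≤ R →
          ursellFourBoxSum (algebraicCoupling 3 C₀ α) β L R ≤
            C * max (β ^ (-(4 : ℝ))) (β ^ (-(2 : ℝ))) * (R : ℝ) ^ γ / (L : ℝ) ^ (((3 : ℕ) : ℝ) - 2 * min α 2) := by
  set J := algebraicCoupling 3 C₀ α with hJdef
  have hJ0 : ∀ x y, 0 ≤ J x y := algebraicCoupling_nonneg hC₀.le α
  have hJt : ∀ a x y, J (x + a) (y + a) = J x y := algebraicCoupling_add C₀ α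
  have hmin : min α 2 = α := by
    apply min_eq_left
    by_contra h
    push Not at h
    rw [min_eq_right h.le] at hexp
    norm_num at hexp
  have hα32 : α < 3 / 2 := by rw [hmin] at hexp; push_cast at hexp; linarith
  set η : ℝ := 2 - α with hη
  have hη0 : 0 ≤ η := by rw [hη]; linarith
  have hη2 : η < 2 := by rw [hη]; linarith
  have hηhalf : 1 / 2 < η := by rw [hη]; linarith
  have hη1 : 0 < 2 * η - 1 := by linarith
  have h2η : 0 < 2 - η := by linarith
  obtain ⟨CE, hCE, hE⟩ := hI 3 le_rfl C₀ α hC₀ hα (by linarith)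
  obtain ⟨C₂, hC₂, hX'⟩ := hX 3 (by norm_num) C₀ α hC₀ hα
  set βc : ℝ := LongRangeIsing.criticalBeta J with hβcdef
  set C₄ : ℝ := 1 + 26 * CE * (1 + 1 / (2 - η)) with hC₄
  set K₁ : ℝ := 2 * 729 * (730 * 125) ^ 4 * C₄ ^ 2 * C₂ ^ 2 with hK₁
  set K₂ : ℝ := 2 * 26 * 9 * 3 ^ 12 * CE ^ 2 * C₂ ^ 2 / (2 * η - 1) with hK₂
  have hK₁0 : 0 ≤ K₁ := by positivity
  have hK₂0 : 0 ≤ K₂ := by positivity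
  refine ⟨(K₁ + K₂ + 1) * max (βc ^ 2) 1, 15, by positivity, by norm_num, ?_⟩
  intro β hβ hβc L R hL hR
  have hL0 : (0 : ℝ) < L := by exact_mod_cast hL
  have hR0 : (0 : ℝ) < R := by exact_mod_cast hR
  -- the facts at this `β`
  have hmms : ∀ x y : Site 3, (3 : ℝ) * ‖x‖ ≤ ‖y‖ → pairCorrelation J β 0 y ≤ pairCorrelation J β 0 x :=
    fun x y h => hM 3 (by norm_num) C₀ α hC₀ hα β hβ x y (by exact_mod_cast h)
  have hEβ : ∀ x : Site 3, x ≠ 0 → pairCorrelation J β 0 x ≤ CE / ‖x‖ ^ (1 + η) := by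
    intro x hx
    have h := hE β hβ hβc x hx
    rwa [hmin, show ((3 : ℕ) : ℝ) - α = 1 + η by rw [hη]; push_cast; ring] at h
  have hXβ : boxSusceptibility J β L ≤ C₂ * ((L : ℝ) ^ 3)⁻¹ * blockVariance J β L := hX' β hβ hβc L hL
  -- the quantities of p. 22
  set χ : ℝ := boxSusceptibility J β L with hχ
  set V : ℝ := blockVariance J β L with hV
  have hχ0 : 0 ≤ χ := boxSusceptibility_nonneg J β hβ.le hJ0 L
  have hV1 : 1 ≤ V := one_le_blockVariance J β hβ.le hJ0 L
  have hV0 : 0 < V := by linarith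
  have hχ4 : χ ≤ C₄ * (L : ℝ) ^ (2 - η) := boxSusceptibility_le_of_irb J β hβ.le hJ0 hη2 hCE.le hEβ hL
  set A : ℝ := (730 * (125 * (R : ℝ) ^ 3) * χ) ^ 4 with hA
  set Bf : ℝ := 9 * CE ^ 2 * ((2 * (R * L) + 1 : ℕ) : ℝ) ^ 12 * χ ^ 2 / (L : ℝ) ^ 6 with hBf
  set q : ℝ := 2 + 2 * η with hq
  set M : ℕ := 4 * (R * L) with hMdef
  have hA0 : 0 ≤ A := by positivity
  have hB0 : 0 ≤ Bf := by positivity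
  have hq3 : 3 < q := by rw [hq]; linarith
  have hRL : 1 ≤ R * L := Nat.one_le_iff_ne_zero.2 (Nat.mul_ne_zero (by omega) (by omega))
  have hM1 : 1 ≤ M := by rw [hMdef]; omega
  -- the majorant of `F⁴`
  have hFg : ∀ u : Site 3, boxRowSum J β (R * L) u ^ 4 ≤ rowMajorant A Bf q M u := by
    intro u
    by_cases hu : u ∈ box 3 M
    · rw [rowMajorant, if_pos hu, hA]
      exact pow_le_pow_left₀ (boxRowSum_nonneg J β hβ.le hJ0 _ u) (boxRowSum_le_near_mms J β hβ.le hJ0 hJt hmms hR hL hu) 4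
    · rw [rowMajorant, if_neg hu, hBf, hq]
      have hu' : 4 * (R * L) + 1 ≤ Site.supNorm u := by
        rw [mem_box_iff_supNorm_le] at hu
        omega
      exact boxRowSum_pow_four_le_far_mms J β hβ.le hJ0 hJt hmms hη0 hη2 hEβ hR hL hu'
  obtain ⟨hsum, htsum⟩ := summable_rowMajorant hA0 hB0 hq3 hM1
  have hU := sum_abs_ursellFour_le J β hβ.le hJ0 (hT 3 (by norm_num) C₀ α hC₀ hα β hβ hβc)
    (rowMajorant_nonneg hA0 hB0 q M) hsum hFg
  -- the two terms
  have hnear : 2 * (#(box 3 (4 * (R * L))) : ℝ) * (730 * (125 * (R : ℝ) ^ 3) * χ) ^ 4 / V ^ 2 ≤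
      K₁ * (R : ℝ) ^ (15 : ℝ) * (L : ℝ) ^ (1 - 2 * η) :=
    near_term_le_mms hχ0 hV1 hR hL hχ4 hXβ
  have hfar : 2 * (9 * CE ^ 2 * ((2 * (R * L) + 1 : ℕ) : ℝ) ^ 12 * χ ^ 2 / (L : ℝ) ^ 6) *
        (26 * (((4 * (R * L) : ℕ) : ℝ)) ^ (3 - (2 + 2 * η)) / (2 + 2 * η - 3)) / V ^ 2 ≤
      K₂ * (R : ℝ) ^ (15 : ℝ) * (L : ℝ) ^ (1 - 2 * η) :=
    far_term_le_mms hχ0 hV1 hηhalf hR hL hXβ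
  -- assemble
  have hS : ursellFourBoxSum J β L R ≤ (K₁ + K₂) * ((R : ℝ) ^ (15 : ℝ) * (L : ℝ) ^ (1 - 2 * η)) := by
    have h1 : ursellFourBoxSum J β L R ≤ 2 * ((#(box 3 M) : ℝ) * A + Bf * (26 * (M : ℝ) ^ (3 - q) / (q - 3))) / V ^ 2 := by
      rw [ursellFourBoxSum]
      exact div_le_div_of_nonneg_right (hU.trans (by linarith only [htsum])) (sq_nonneg _)
    have h2 : 2 * ((#(box 3 M) : ℝ) * A + Bf * (26 * (M : ℝ) ^ (3 - q) / (q - 3))) / V ^ 2 =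
        2 * (#(box 3 (4 * (R * L))) : ℝ) * (730 * (125 * (R : ℝ) ^ 3) * χ) ^ 4 / V ^ 2 +
        2 * (9 * CE ^ 2 * ((2 * (R * L) + 1 : ℕ) : ℝ) ^ 12 * χ ^ 2 / (L : ℝ) ^ 6) *
          (26 * (((4 * (R * L) : ℕ) : ℝ)) ^ (3 - (2 + 2 * η)) / (2 + 2 * η - 3)) / V ^ 2 := by
      rw [hA, hBf, hq, hMdef]
      ring
    rw [h2] at h1
    linarith only [h1, hnear, hfar]
  -- `1 ≤ (β_c² ∨ 1) (β⁻⁴ ∨ β⁻²)` for `0 < β ≤ β_c`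
  have hβc0 : 0 < βc := lt_of_lt_of_le hβ hβc
  have hm2 : β ^ (-(2 : ℝ)) ≤ max (β ^ (-(4 : ℝ))) (β ^ (-(2 : ℝ))) := le_max_right _ _
  have hm0 : 0 ≤ max (β ^ (-(4 : ℝ))) (β ^ (-(2 : ℝ))) := le_max_of_le_left (Real.rpow_nonneg hβ.le _)
  have hone : 1 ≤ max (βc ^ 2) 1 * max (β ^ (-(4 : ℝ))) (β ^ (-(2 : ℝ))) := by
    have h1 : β ^ (-(2 : ℝ)) = (β ^ 2)⁻¹ := by
      rw [Real.rpow_neg hβ.le, show (2 : ℝ) = ((2 : ℕ) : ℝ) by norm_num, Real.rpow_natCast]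
    have h2 : 1 ≤ βc ^ 2 * (β ^ 2)⁻¹ := by
      rw [← div_eq_mul_inv, le_div_iff₀ (by positivity), one_mul]
      exact pow_le_pow_left₀ hβ.le hβc 2
    calc (1 : ℝ) ≤ βc ^ 2 * (β ^ 2)⁻¹ := h2
      _ ≤ max (βc ^ 2) 1 * max (β ^ (-(4 : ℝ))) (β ^ (-(2 : ℝ))) := by
          rw [← h1]
          exact mul_le_mul (le_max_left _ _) hm2 (by positivity) (by positivity)
  have hX0 : 0 ≤ (R : ℝ) ^ (15 : ℝ) * (L : ℝ) ^ (1 - 2 * η) := mul_nonneg (Real.rpow_nonneg hR0.le _) (Real.rpow_nonneg hL0.le _)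
  have hcoef : K₁ + K₂ ≤ (K₁ + K₂ + 1) * max (βc ^ 2) 1 * max (β ^ (-(4 : ℝ))) (β ^ (-(2 : ℝ))) := by
    have h := mul_le_mul_of_nonneg_left hone (by positivity : 0 ≤ K₁ + K₂ + 1)
    rw [mul_one, ← mul_assoc] at h
    linarith
  have hpow : (R : ℝ) ^ (15 : ℝ) * (L : ℝ) ^ (1 - 2 * η) = (R : ℝ) ^ (15 : ℝ) / (L : ℝ) ^ (((3 : ℕ) : ℝ) - 2 * min α 2) := by
    rw [hmin, show (1 : ℝ) - 2 * η = -(((3 : ℕ) : ℝ) - 2 * α) by rw [hη]; push_cast; ring, Real.rpow_neg hL0.le,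
      div_eq_mul_inv]
  calc ursellFourBoxSum J β L R ≤ (K₁ + K₂) * ((R : ℝ) ^ (15 : ℝ) * (L : ℝ) ^ (1 - 2 * η)) := hS
    _ ≤ (K₁ + K₂ + 1) * max (βc ^ 2) 1 * max (β ^ (-(4 : ℝ))) (β ^ (-(2 : ℝ))) *
        ((R : ℝ) ^ (15 : ℝ) * (L : ℝ) ^ (1 - 2 * η)) := mul_le_mul_of_nonneg_right hcoef hX0
    _ = (K₁ + K₂ + 1) * max (βc ^ 2) 1 * max (β ^ (-(4 : ℝ))) (β ^ (-(2 : ℝ))) * (R : ℝ) ^ (15 : ℝ) /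
        (L : ℝ) ^ (((3 : ℕ) : ℝ) - 2 * min α 2) := by
        rw [hpow, mul_div_assoc]

/-- The `d = 3` instance of Theorem 1.2 (`panis_thm12_dim3`) from the printed facts WITHOUT the
sliding-scale infrared bound: the moment-generating-function bound (`…Inputs`, from `…Moments`), the
tree diagram bound, MMS2, the infrared bound and `χ_L ≤ C₂L^{-3}Σ_L`.
[cite: Panis2023Triviality, Theorem 1.2 (d = 3) and proof of Theorem 5.5] -/
theorem panis_thm12_dim3_of_twoPoint_mms (hMgf : panis_mgfDeviation_le_ursellFourBoxSum)
    (hT : panis_treeDiagramBound) (hM : panis_mms_two_point_monotone)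
    (hI : panis_infraredBound_algebraic) (hX : panis_boxSusceptibility_le_blockVariance) : panis_thm12_dim3 := by
  intro C₀ α hC₀ hα hexp f hf hfs
  set J := algebraicCoupling 3 C₀ α with hJ
  obtain ⟨C₁, hC₁, hMb⟩ := hMgf 3 (by norm_num) C₀ α hC₀ hα hexp
  obtain ⟨C, γ, hC, _, hSb⟩ := panis_ursellFourBoxSum_le_dim3_mms hT hM hI hX hC₀ hα hexp
  obtain ⟨R, hR, hfR⟩ := exists_nat_forall_abs_apply_le f hfs
  set F : ℝ := (⨆ x, |f x|) ^ 4 with hF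
  have hF0 : 0 ≤ F := pow_nonneg (Real.iSup_nonneg fun x => abs_nonneg (f x)) 4
  refine ⟨C₁ * (F + 1) * C * (R : ℝ) ^ γ, by positivity, fun β hβ hβc L hL z => ?_⟩
  set Vz : ℝ := state J β 0 (fun σ => smeared J β L (fun x => |f x|) σ ^ 2) with hVz
  set m : ℝ := max (β ^ (-(4 : ℝ))) (β ^ (-(2 : ℝ))) with hm
  set E : ℝ := (L : ℝ) ^ (((3 : ℕ) : ℝ) - 2 * min α 2) with hE
  have hm0 : 0 ≤ m := le_max_of_le_left (Real.rpow_nonneg hβ.le _)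
  have hE0 : 0 < E := Real.rpow_pos_of_pos (by exact_mod_cast hL) _
  have h1 := hMb β hβ hβc L R hL hR f hf hfR z
  have h2 := hSb β hβ hβc L R hL hR
  have hS0 : 0 ≤ ursellFourBoxSum J β L R := ursellFourBoxSum_nonneg J β L R
  calc mgfDeviation J β L f z
      ≤ C₁ * z ^ 4 * Real.exp (z ^ 2 / 2 * Vz) * F * ursellFourBoxSum J β L R := h1
    _ ≤ C₁ * z ^ 4 * Real.exp (z ^ 2 / 2 * Vz) * (F + 1) * (C * m * (R : ℝ) ^ γ / E) := by
        apply mul_le_mul _ h2 hS0 (by positivity)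
        exact mul_le_mul_of_nonneg_left (by linarith) (by positivity)
    _ = Real.exp (z ^ 2 / 2 * Vz) * (C₁ * (F + 1) * C * (R : ℝ) ^ γ * m * z ^ 4 / E) := by ring

-- names the `@[deprecated]` (refuted) fact `panis_evenMoment_deviation_le` of `…Moments` on purpose: a vacuous record
-- of the printed chain (verdict clean-up 2026-08-16, `…Moments` §Verdict clean-up); REMOVE-WHEN this theorem is retired
set_option linter.deprecated false in
/-- **The barrier from printed facts WITHOUT Theorem 3.18**: as `LongRangeTrivialityOnZ3.of_twoPoint`
but with `panis_ursellFourBoxSum_le_dim3_mms` in place of `panis_ursellFourBoxSum_le_dim3`.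
**Vacuous since 2026-08-16:** the hypothesis `panis_evenMoment_deviation_le` is refuted
(`not_panis_evenMoment_deviation_le_of_criticalBeta_pos`, `…Wick`, with
`panis_criticalBeta_pos_holds`; `…Moments`, §Verdict clean-up) — the conclusion is meanwhile a
theorem outright (`panis_mgfDeviation_le_ursellFourBoxSum_holds`, `panis_thm12_holds`,
`LongRangeTrivialityOnZ3_holds`).
[cite: Panis2023Triviality, Theorem 1.2 and proof of Theorem 5.5] -/
theorem LongRangeTrivialityOnZ3.of_twoPoint_mms (h51 : panis_evenMoment_deviation_le)
    (hN : newman_gaussian_evenMoment_le) (hT : panis_treeDiagramBound) (hM : panis_mms_two_point_monotone)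
    (hI : panis_infraredBound_algebraic) (hX : panis_boxSusceptibility_le_blockVariance) : LongRangeTrivialityOnZ3 :=
  LongRangeTrivialityOnZ3.of_thm12_dim3
    (panis_thm12_dim3_of_twoPoint_mms (panis_mgfDeviation_le_ursellFourBoxSum_of_moments h51 hN) hT hM hI hX)

-- names the `@[deprecated]` (refuted) fact `panis_evenMoment_deviation_le` of `…Moments` on purpose: a vacuous record
-- of the printed chain (verdict clean-up 2026-08-16, `…Moments` §Verdict clean-up); REMOVE-WHEN this theorem is retired
set_option linter.deprecated false in
/-- **The barrier `LongRangeTrivialityOnZ3` from FOUR printed facts**: the random-current moment bound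
`panis_evenMoment_deviation_le` (Proposition 4.6 summed), the Gaussian moment bound
`newman_gaussian_evenMoment_le`, Aizenman's tree diagram bound `panis_treeDiagramBound` and the infrared
bound `panis_infraredBound_algebraic` — the Messager–Miracle-Solé monotonicity being PROVED
(`panis_mms_two_point_monotone_holds`, `…MMSWalk`), `χ_L ≤ C₂L^{-d}Σ_L` derived from it
(`panis_boxSusceptibility_le_blockVariance_of_mms`, `…Susceptibility`), and the sliding-scale infrared
bound not needed (`panis_ursellFourBoxSum_le_dim3_mms`).
**Vacuous since 2026-08-16:** the hypothesis `panis_evenMoment_deviation_le` is refuted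
(`not_panis_evenMoment_deviation_le_of_criticalBeta_pos`, `…Wick`, with
`panis_criticalBeta_pos_holds`; `…Moments`, §Verdict clean-up) — the conclusion is meanwhile a
theorem outright (`panis_mgfDeviation_le_ursellFourBoxSum_holds`, `panis_thm12_holds`,
`LongRangeTrivialityOnZ3_holds`).
[cite: Panis2023Triviality, Theorem 1.2 and proof of Theorem 5.5] -/
theorem LongRangeTrivialityOnZ3.of_fourFacts (h51 : panis_evenMoment_deviation_le)
    (hN : newman_gaussian_evenMoment_le) (hT : panis_treeDiagramBound)
    (hI : panis_infraredBound_algebraic) : LongRangeTrivialityOnZ3 :=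
  LongRangeTrivialityOnZ3.of_twoPoint_mms h51 hN hT panis_mms_two_point_monotone_holds hI
    (panis_boxSusceptibility_le_blockVariance_of_mms panis_mms_two_point_monotone_holds)

/-! ### The coupling matrix of `|x-y|₁^{-3}` across the diagonal of `ℤ²` is not positive semidefinite -/

namespace LongRangeIsing

/-- `J_{p,q} = |p-q|₁^{-3}` for `p ≠ q` when `d = 2`, `C₀ = 1`, `α = 1`. [folklore] -/
theorem algebraicCoupling_two_one_one {p q : Site 2} (hpq : p ≠ q) :
    algebraicCoupling 2 1 1 p q = (((l1Norm (p - q)) : ℝ) ^ 3)⁻¹ := by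
  rw [algebraicCoupling, if_neg hpq, one_mul, Real.rpow_neg (Nat.cast_nonneg _),
    show ((2 : ℕ) : ℝ) + 1 = ((3 : ℕ) : ℝ) by norm_num, Real.rpow_natCast]

/-- **The coupling matrix of `J = |x-y|₁^{-3}` across the diagonal mirror of `ℤ²` is not positive
semidefinite.** With `R(a,b) = (b,a)` the reflection through `{x₀ = x₁}` (the mirror of the proof of
Proposition 3.16 of the source up to the symmetry `x₁ ↦ -x₁` of `|·|₁`): for the four sites `(1,0), (0,-1), (2,1), (-1,-2)` (all strictly below the diagonal,
`x₁ < x₀`) and the weights `(-1, 1, 1, -1)`, `∑ᵢⱼ vᵢvⱼ J_{xᵢ, R xⱼ} = -85/432 < 0` (the sixteen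
distances `|xᵢ - Rxⱼ|₁` are `2,2,2,4; 2,2,4,2; 2,4,2,6; 4,2,6,2`). Hence the decomposition
`-H = A + R(A) + ∑_α c_αC_αR(C_α)`, `c_α ≥ 0`, behind reflection positivity of pair interactions
(Friedli–Velenik 2017, Lemma 10.8) is unavailable for the algebraically decaying `ℓ¹` couplings and
the diagonal mirrors invoked in the proof of Proposition 3.16 of the source (see the module docstring;
coordinate mirrors are not affected). [cite: FriedliVelenik2017, Lemma 10.8] -/
theorem algebraicCoupling_diag_not_posSemidef :
    ∃ (x : Fin 4 → Site 2) (v : Fin 4 → ℝ), (∀ i, x i 1 < x i 0) ∧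
      ∑ i, ∑ j, v i * v j * algebraicCoupling 2 1 1 (x i) ![x j 1, x j 0] < 0 := by
  refine ⟨![![1, 0], ![0, -1], ![2, 1], ![-1, -2]], ![-1, 1, 1, -1], ?_, ?_⟩
  · intro i
    fin_cases i <;> decide
  · simp only [Fin.sum_univ_four, Matrix.cons_val_zero, Matrix.cons_val_one, Matrix.cons_val_two,
      Matrix.cons_val_three, Matrix.head_cons, Matrix.tail_cons]
    rw [algebraicCoupling_two_one_one (by decide), algebraicCoupling_two_one_one (by decide),
      algebraicCoupling_two_one_one (by decide), algebraicCoupling_two_one_one (by decide),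
      algebraicCoupling_two_one_one (by decide), algebraicCoupling_two_one_one (by decide),
      algebraicCoupling_two_one_one (by decide), algebraicCoupling_two_one_one (by decide),
      algebraicCoupling_two_one_one (by decide), algebraicCoupling_two_one_one (by decide),
      algebraicCoupling_two_one_one (by decide), algebraicCoupling_two_one_one (by decide),
      algebraicCoupling_two_one_one (by decide), algebraicCoupling_two_one_one (by decide),
      algebraicCoupling_two_one_one (by decide), algebraicCoupling_two_one_one (by decide)]
    have h : ∀ p : Site 2, ∀ n : ℕ, l1Norm p = n → (((l1Norm p) : ℝ) ^ 3)⁻¹ = ((n : ℝ) ^ 3)⁻¹ := by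
      rintro p n rfl; rfl
    rw [h _ 2 (by decide), h _ 2 (by decide), h _ 2 (by decide), h _ 4 (by decide),
      h _ 2 (by decide), h _ 2 (by decide), h _ 4 (by decide), h _ 2 (by decide),
      h _ 2 (by decide), h _ 4 (by decide), h _ 2 (by decide), h _ 6 (by decide),
      h _ 4 (by decide), h _ 2 (by decide), h _ 6 (by decide), h _ 2 (by decide)]
    norm_num

end LongRangeIsing

end Literature.Barriers.CriticalPhenomena

end
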